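import Mathlib
import HarnessLib
import Summits.HubbardSuperconductivity.HubbardSuperconductivity.Theorems.KLProgrammeC4aPreCausticLevelLine

/-!
# Route `KLProgramme` — crux C4a, S3 brick (B4) «(B4)-UMK1», «(M1)-SCALING»: the ANTI-DIAGONAL FLATNESS NUMBER of a kernel `K(e,u) = N(e,u)·κ(e/(e+u))/(e+u)`
# (cutoff numerator `N` × degree-(−1) homogeneous bulk) is `≤ 8cκ₀·lo/D²` — by an integration by parts along the anti-diagonal `e + u = D`, the bulk cancels
# exactly and only the cutoff derivatives (size `c/lo` on a set of length `2lo`, weighted by `e/D ≤ 2lo/D`) survive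

Cell `gate-hubbard-kl`, seat hubbard-kl-k3c3-p3 (g29; row «implicit-function / monotonicity route for μ(n)»).  Located brick for the (C)-closer lane hubbard-kl-c4a-1
(stub (C) `stub_twoLeg_curvature` of `KLRegimeEngineV17F2`, stmt-HubbardSuperconductivity-20437), memo HOME/hubbard-kl-k3c3-p3/U1-CAUSTIC-SUP.md §4 (N2) / §7–§8 REMAINING (M1).
`…C4aPreCausticLevelLine.abs_intervalIntegral_deformed_antidiagonal_le` isolates ONE model-side number, the anti-diagonal flatness `|∫ w(e)·∂_uK(e, D − e) de| ≤ A_fl`, target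
`A_fl = A·lo/max(D,lo)²` («model B: exact»; «an explicit computation with the cutoff functions, not an envelope»).  This file proves it ONCE for the structural class the
memo names (`K = N/(e+u)`-type kernels with cutoffs at scale `lo`; the finer-line split as a smooth function `κ` of the RATIO `e/(e+u)`), reducing (M1) to a structural check:
* §1 `hasDerivAt_ratioKernel_u`: `∂_u[N(e,u)κ(e/(e+u))/(e+u)] = ∂_uN·κ(t)/(e+u) − N·(κ′(t)t + κ(t))/(e+u)²`, `t = e/(e+u)` — on the anti-diagonal the bulk part is
  `−N·m′(e)/D` with `m(e) = (e/D)κ(e/D)` (a total `e`-derivative: the degree-(−1) homogeneity);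
* §2 `abs_intervalIntegral_le_of_small_support_left/right`: `|g| ≤ (c/lo)(e/D)κ₀` with `g = 0` for `e ≥ 2lo` (resp. the mirror at `D`) ⟹ `|∫_0^D g| ≤ 4cκ₀lo/D`;
* §3 **`abs_integral_antidiagonal_flatness_le`**: along `e ∈ [0,D]` let `n(e) = N(e,D−e)` with `n′ = n₁ − n₂` (`n₁ = ∂_eN`, `n₂ = ∂_uN` on the line), `n(D) = 0`
  (`N(D,0) = 0`: the `u`-cutoff), `|n₁|,|n₂| ≤ c/lo`, `n₁ = 0` for `e ≥ 2lo`, `n₂ = 0` for `e ≤ D − 2lo`, `|κ| ≤ κ₀` on `[0,1]`; then for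
  `Ku(e) = n₂κ(e/D)/D − n(κ′(e/D)(e/D) + κ(e/D))/D²` (= `∂_uK(e, D−e)` by §1):  `|∫_0^D Ku| ≤ 8cκ₀·lo/D²`
  (IBP: `∫ n·m′ = −∫ (n₁ − n₂)·m`, so `∫ Ku = (1/D)∫ [n₁·(e/D) + n₂·(1 − e/D)]·κ(e/D)`; each piece by §2);
* §4 `abs_integral_antidiagonal_flatness_modelB_le`: the instance `N(e,u) = ν(e)ν(u)`, `κ ≡ 1` (model B with smooth steps: `ν(0) = 0`, `|ν| ≤ 1`, `|ν′| ≤ c/lo`, `ν′ = 0` on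
  `[2lo, ∞)`): `|∫_0^D ν(e)·∂_u[ν(u)/(e+u)](e, D−e) de| ≤ 8c·lo/D²` — the verification pattern (w52).
With `w ≡ W` constant (the level shell absorbed in `N`) this is the `hflat` of `…PreCausticLevelLine` with `A_fl = 8Wcκ₀·lo/D²` on any line `[a,b] ⊇` the support.
Pure real analysis; nothing about the model; nothing asserts (C), K3 or superconductivity.
References: FST II CPAM 51 (1998) §3 [cite: FeldmanSalmhoferTrubowitz1998]; Salmhofer 1999 §4.5.3 [cite: Salmhofer1999].
-/

noncomputable section

namespace Summit.HubbardSuperconductivity.HubbardSuperconductivity.Theorems.C4a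

set_option linter.dupNamespace false -- summit = problem name (single-conjunct summit), D-0017

open Real Set MeasureTheory intervalIntegral
open scoped Interval

/-! ## §1 The `u`-derivative of a ratio kernel -/

/-- **`∂_u[N(u)·κ(e/(e+u))/(e+u)]`** at a point with `e + u ≠ 0`: `N′κ(t)/(e+u) − N·(κ′(t)·t + κ(t))/(e+u)²`, `t = e/(e+u)`. [folklore] -/
theorem hasDerivAt_ratioKernel_u {Nu κ : ℝ → ℝ} {Nu' κ' e u : ℝ} (hs : e + u ≠ 0) (hN : HasDerivAt Nu Nu' u)
    (hκ : HasDerivAt κ κ' (e / (e + u))) :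
    HasDerivAt (fun x : ℝ => Nu x * κ (e / (e + x)) / (e + x))
      (Nu' * κ (e / (e + u)) / (e + u) - Nu u * (κ' * (e / (e + u)) + κ (e / (e + u))) / (e + u) ^ 2) u := by
  have hsum : HasDerivAt (fun x : ℝ => e + x) 1 u := by simpa using (hasDerivAt_id u).const_add e
  have hrat : HasDerivAt (fun x : ℝ => e / (e + x)) (-e / (e + u) ^ 2) u := by
    have h := (hasDerivAt_const u e).div hsum hs
    have hfun : ((fun _ : ℝ => e) / fun x : ℝ => e + x) = fun x : ℝ => e / (e + x) := by
      funext x; simp [Pi.div_apply]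
    rw [hfun] at h
    exact h.congr_deriv (by ring)
  have hκc : HasDerivAt (fun x : ℝ => κ (e / (e + x))) (κ' * (-e / (e + u) ^ 2)) u := hκ.comp u hrat
  have hprod : HasDerivAt (fun x : ℝ => Nu x * κ (e / (e + x))) (Nu' * κ (e / (e + u)) + Nu u * (κ' * (-e / (e + u) ^ 2))) u :=
    hN.mul hκc
  have h := hprod.div hsum hs
  refine h.congr_deriv ?_
  field_simp
  ring

/-! ## §2 Integrals of functions of small support near an end of the line -/

/-- **Small support at the left end**: `0 < D`, `0 < lo`, `0 ≤ c, κ₀`; on `[0,D]`, `|g e| ≤ (c/lo)·(e/D)·κ₀` and `g e = 0` for `2lo ≤ e`.  THEN `|∫_0^D g| ≤ 4cκ₀·lo/D`. -/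
theorem abs_intervalIntegral_le_of_small_support_left {g : ℝ → ℝ} {D lo c κ₀ : ℝ} (hD : 0 < D) (hlo : 0 < lo) (hc : 0 ≤ c) (hκ₀ : 0 ≤ κ₀)
    (hg : ∀ e ∈ Icc 0 D, |g e| ≤ c / lo * (e / D) * κ₀) (hgs : ∀ e ∈ Icc 0 D, 2 * lo ≤ e → g e = 0) :
    |∫ e in (0 : ℝ)..D, g e| ≤ 4 * c * κ₀ * lo / D := by
  rcases le_or_gt D (2 * lo) with hsmall | hbig
  · -- short line: constant bound `(c/lo)κ₀` over length `D ≤ 2lo`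
    have hbd : ∀ e ∈ Ι (0 : ℝ) D, ‖g e‖ ≤ c / lo * κ₀ := fun e he => by
      rw [uIoc_of_le hD.le] at he
      rw [Real.norm_eq_abs]
      refine (hg e ⟨he.1.le, he.2⟩).trans ?_
      have h1 : e / D ≤ 1 := (div_le_one hD).2 he.2
      have h2 : 0 ≤ c / lo := div_nonneg hc hlo.le
      nlinarith [mul_nonneg h2 hκ₀]
    have h := intervalIntegral.norm_integral_le_of_norm_le_const hbd
    rw [Real.norm_eq_abs, sub_zero, abs_of_pos hD] at h
    refine h.trans ?_
    -- `(c/lo)κ₀·D ≤ 4cκ₀lo/D` since `D² ≤ 4lo²`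
    rw [le_div_iff₀ hD]
    have h3 : D * D ≤ 2 * lo * (2 * lo) := mul_le_mul hsmall hsmall hD.le (by linarith)
    have h4 : c / lo * κ₀ * D * D = c * κ₀ * (D * D) / lo := by field_simp
    rw [h4, div_le_iff₀ hlo]
    nlinarith [mul_nonneg hc hκ₀]
  · -- long line: the integrand vanishes on `[2lo, D]`
    by_cases hint : IntervalIntegrable g volume 0 D
    swap
    · rw [intervalIntegral.integral_undef hint, abs_zero]; positivity
    have h2lo : 0 ≤ 2 * lo := by linarith
    have hi1 : IntervalIntegrable g volume 0 (2 * lo) :=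
      hint.mono_set (by rw [uIcc_of_le h2lo, uIcc_of_le hD.le]; exact Icc_subset_Icc le_rfl hbig.le)
    have hi2 : IntervalIntegrable g volume (2 * lo) D :=
      hint.mono_set (by rw [uIcc_of_le hbig.le, uIcc_of_le hD.le]; exact Icc_subset_Icc h2lo le_rfl)
    rw [← integral_add_adjacent_intervals hi1 hi2]
    have hzero : ∫ e in (2 * lo)..D, g e = 0 := by
      rw [← intervalIntegral.integral_zero (a := 2 * lo) (b := D) (μ := volume)]
      refine intervalIntegral.integral_congr fun e he => ?_
      rw [uIcc_of_le hbig.le] at he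
      exact hgs e ⟨h2lo.trans he.1, he.2⟩ he.1
    rw [hzero, add_zero]
    have hbd : ∀ e ∈ Ι (0 : ℝ) (2 * lo), ‖g e‖ ≤ c / lo * (2 * lo / D) * κ₀ := fun e he => by
      rw [uIoc_of_le h2lo] at he
      rw [Real.norm_eq_abs]
      refine (hg e ⟨he.1.le, he.2.trans hbig.le⟩).trans ?_
      have h1 : e / D ≤ 2 * lo / D := div_le_div_of_nonneg_right he.2 hD.le
      have h2 : 0 ≤ c / lo := div_nonneg hc hlo.le
      exact mul_le_mul_of_nonneg_right (mul_le_mul_of_nonneg_left h1 h2) hκ₀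
    have h := intervalIntegral.norm_integral_le_of_norm_le_const hbd
    rw [Real.norm_eq_abs, sub_zero, abs_of_nonneg h2lo] at h
    refine h.trans (le_of_eq ?_)
    field_simp
    ring

/-- **Small support at the right end** (mirror): `|g e| ≤ (c/lo)·((D − e)/D)·κ₀` on `[0,D]` and `g e = 0` for `e ≤ D − 2lo` ⟹ `|∫_0^D g| ≤ 4cκ₀·lo/D`. -/
theorem abs_intervalIntegral_le_of_small_support_right {g : ℝ → ℝ} {D lo c κ₀ : ℝ} (hD : 0 < D) (hlo : 0 < lo) (hc : 0 ≤ c) (hκ₀ : 0 ≤ κ₀)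
    (hg : ∀ e ∈ Icc 0 D, |g e| ≤ c / lo * ((D - e) / D) * κ₀) (hgs : ∀ e ∈ Icc 0 D, e ≤ D - 2 * lo → g e = 0) :
    |∫ e in (0 : ℝ)..D, g e| ≤ 4 * c * κ₀ * lo / D := by
  have hsub : ∫ e in (0 : ℝ)..D, g e = ∫ e in (0 : ℝ)..D, g (D - e) := by
    rw [intervalIntegral.integral_comp_sub_left g D, sub_self, sub_zero]
  rw [hsub]
  refine abs_intervalIntegral_le_of_small_support_left hD hlo hc hκ₀ (fun e he => ?_) (fun e he h2 => ?_)
  · have h := hg (D - e) ⟨by linarith [he.2], by linarith [he.1]⟩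
    rwa [sub_sub_cancel] at h
  · exact hgs (D - e) ⟨by linarith [he.2], by linarith [he.1]⟩ (by linarith)

/-! ## §3 The flatness number -/

/-- **THE ANTI-DIAGONAL FLATNESS NUMBER OF A RATIO KERNEL WITH CUTOFF NUMERATOR.**  `0 < D`, `0 < lo`, `0 ≤ c, κ₀`.  Along `e ∈ [0,D]`: `n` (the numerator `N(e, D−e)`)
with `n′ = n₁ − n₂` (`n₁ = ∂_eN`, `n₂ = ∂_uN` on the line; continuous), `n(D) = 0`; cutoff derivatives `|n₁|, |n₂| ≤ c/lo`, `n₁ = 0` for `e ≥ 2lo`, `n₂ = 0` for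
`e ≤ D − 2lo`; the split/bulk profile `κ ∈ C¹` with `|κ| ≤ κ₀` on `[0,1]`; and `Ku(e) = n₂κ(e/D)/D − n·(κ′(e/D)(e/D) + κ(e/D))/D²` on `[0,D]` (`= ∂_uK(e, D−e)` for
`K = Nκ(e/(e+u))/(e+u)`, §1).  THEN  `|∫_0^D Ku| ≤ 8cκ₀·lo/D²`. -/
theorem abs_integral_antidiagonal_flatness_le {n n₁ n₂ κ κ' Ku : ℝ → ℝ} {D lo c κ₀ : ℝ} (hD : 0 < D) (hlo : 0 < lo) (hc : 0 ≤ c) (hκ₀ : 0 ≤ κ₀)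
    (hn : ∀ e ∈ Icc 0 D, HasDerivAt n (n₁ e - n₂ e) e) (hn₁c : Continuous n₁) (hn₂c : Continuous n₂)
    (hκ : ∀ t, HasDerivAt κ (κ' t) t) (hκ'c : Continuous κ')
    (hnD : n D = 0)
    (hn₁b : ∀ e ∈ Icc 0 D, |n₁ e| ≤ c / lo) (hn₁s : ∀ e ∈ Icc 0 D, 2 * lo ≤ e → n₁ e = 0)
    (hn₂b : ∀ e ∈ Icc 0 D, |n₂ e| ≤ c / lo) (hn₂s : ∀ e ∈ Icc 0 D, e ≤ D - 2 * lo → n₂ e = 0)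
    (hκb : ∀ t ∈ Icc 0 1, |κ t| ≤ κ₀)
    (hKu : ∀ e ∈ Icc 0 D, Ku e = n₂ e * κ (e / D) / D - n e * (κ' (e / D) * (e / D) + κ (e / D)) / D ^ 2) :
    |∫ e in (0 : ℝ)..D, Ku e| ≤ 8 * c * κ₀ * lo / D ^ 2 := by
  have hκc : Continuous κ := continuous_iff_continuousAt.2 fun t => (hκ t).continuousAt
  have hD0 : D ≠ 0 := hD.ne'
  -- the bulk primitive `m(e) = (e/D)·κ(e/D)` and its derivative
  set m : ℝ → ℝ := fun e => e / D * κ (e / D) with hm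
  set m' : ℝ → ℝ := fun e => (κ' (e / D) * (e / D) + κ (e / D)) / D with hm'
  have hmd : ∀ e, HasDerivAt m (m' e) e := fun e => by
    have h1 : HasDerivAt (fun e : ℝ => e / D) (1 / D) e := by simpa using (hasDerivAt_id e).div_const D
    have h2 : HasDerivAt (fun e : ℝ => κ (e / D)) (κ' (e / D) * (1 / D)) e := (hκ (e / D)).comp e h1
    have h := h1.mul h2
    refine h.congr_deriv ?_
    simp only [hm']
    field_simp
    ring
  have hm'c : Continuous m' := by
    simp only [hm']
    exact (((hκ'c.comp (continuous_id.div_const D)).mul (continuous_id.div_const D)).add (hκc.comp (continuous_id.div_const D))).div_const D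
  have hnc : ContinuousOn n (Icc 0 D) := fun e he => (hn e he).continuousAt.continuousWithinAt
  -- integration by parts: `∫ n·m′ = n D m D − n 0 m 0 − ∫ (n₁ − n₂)·m = −∫ (n₁ − n₂)·m`
  have hIBP : ∫ e in (0 : ℝ)..D, n e * m' e = -∫ e in (0 : ℝ)..D, (n₁ e - n₂ e) * m e := by
    have h := intervalIntegral.integral_mul_deriv_eq_deriv_mul (a := (0 : ℝ)) (b := D) (u := n) (v := m) (u' := fun e => n₁ e - n₂ e) (v' := m')
      (fun e he => hn e (by rwa [uIcc_of_le hD.le] at he)) (fun e _ => hmd e)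
      ((hn₁c.sub hn₂c).intervalIntegrable _ _) (hm'c.intervalIntegrable _ _)
    rw [h, hnD]
    simp [hm]
  -- rewrite the integrand
  have hKu' : ∀ e ∈ uIcc (0 : ℝ) D, Ku e = (1 / D) * (n₂ e * κ (e / D)) - (1 / D) * (n e * m' e) := fun e he => by
    rw [uIcc_of_le hD.le] at he
    rw [hKu e he]
    simp only [hm']
    field_simp
  have hi₂ : IntervalIntegrable (fun e => n₂ e * κ (e / D)) volume 0 D := (hn₂c.mul (hκc.comp (continuous_id.div_const D))).intervalIntegrable _ _
  have hi₃ : IntervalIntegrable (fun e => n e * m' e) volume 0 D := by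
    refine (hnc.mul hm'c.continuousOn).intervalIntegrable_of_Icc hD.le
  rw [intervalIntegral.integral_congr hKu', intervalIntegral.integral_sub (hi₂.const_mul _) (hi₃.const_mul _),
    intervalIntegral.integral_const_mul, intervalIntegral.integral_const_mul, hIBP]
  -- combine into the two cutoff pieces
  have hi₄ : IntervalIntegrable (fun e => n₁ e * m e) volume 0 D :=
    (hn₁c.mul ((continuous_id.div_const D).mul (hκc.comp (continuous_id.div_const D)))).intervalIntegrable _ _
  have hi₅ : IntervalIntegrable (fun e => n₂ e * ((D - e) / D * κ (e / D))) volume 0 D :=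
    (hn₂c.mul (((continuous_const.sub continuous_id).div_const D).mul (hκc.comp (continuous_id.div_const D)))).intervalIntegrable _ _
  have hsplit : (∫ e in (0 : ℝ)..D, n₂ e * κ (e / D)) + ∫ e in (0 : ℝ)..D, (n₁ e - n₂ e) * m e =
      (∫ e in (0 : ℝ)..D, n₁ e * m e) + ∫ e in (0 : ℝ)..D, n₂ e * ((D - e) / D * κ (e / D)) := by
    have hi₆ : IntervalIntegrable (fun e => (n₁ e - n₂ e) * m e) volume 0 D :=
      ((hn₁c.sub hn₂c).mul ((continuous_id.div_const D).mul (hκc.comp (continuous_id.div_const D)))).intervalIntegrable _ _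
    rw [← intervalIntegral.integral_add hi₂ hi₆, ← intervalIntegral.integral_add hi₄ hi₅]
    refine intervalIntegral.integral_congr fun e _ => ?_
    simp only [hm]
    field_simp
    ring
  have hcomb : 1 / D * (∫ e in (0 : ℝ)..D, n₂ e * κ (e / D)) - 1 / D * -∫ e in (0 : ℝ)..D, (n₁ e - n₂ e) * m e =
      1 / D * ((∫ e in (0 : ℝ)..D, n₁ e * m e) + ∫ e in (0 : ℝ)..D, n₂ e * ((D - e) / D * κ (e / D))) := by
    rw [← hsplit]; ring
  rw [hcomb]
  -- the two cutoff pieces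
  have hκe : ∀ e ∈ Icc (0 : ℝ) D, |κ (e / D)| ≤ κ₀ := fun e he =>
    hκb (e / D) ⟨div_nonneg he.1 hD.le, (div_le_one hD).2 he.2⟩
  have hp1 : |∫ e in (0 : ℝ)..D, n₁ e * m e| ≤ 4 * c * κ₀ * lo / D := by
    refine abs_intervalIntegral_le_of_small_support_left hD hlo hc hκ₀ (fun e he => ?_) (fun e he h2 => ?_)
    · simp only [hm]
      rw [abs_mul, abs_mul, abs_of_nonneg (div_nonneg he.1 hD.le)]
      have h1 := hn₁b e he
      have h2 := hκe e he
      have h3 : 0 ≤ e / D := div_nonneg he.1 hD.le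
      calc |n₁ e| * (e / D * |κ (e / D)|) ≤ c / lo * (e / D * κ₀) :=
            mul_le_mul h1 (mul_le_mul_of_nonneg_left h2 h3) (by positivity) (div_nonneg hc hlo.le)
        _ = c / lo * (e / D) * κ₀ := by ring
    · rw [hn₁s e he h2, zero_mul]
  have hp2 : |∫ e in (0 : ℝ)..D, n₂ e * ((D - e) / D * κ (e / D))| ≤ 4 * c * κ₀ * lo / D := by
    refine abs_intervalIntegral_le_of_small_support_right hD hlo hc hκ₀ (fun e he => ?_) (fun e he h2 => ?_)
    · rw [abs_mul, abs_mul, abs_of_nonneg (div_nonneg (by linarith [he.2]) hD.le)]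
      have h1 := hn₂b e he
      have h2 := hκe e he
      have h3 : 0 ≤ (D - e) / D := div_nonneg (by linarith [he.2]) hD.le
      calc |n₂ e| * ((D - e) / D * |κ (e / D)|) ≤ c / lo * ((D - e) / D * κ₀) :=
            mul_le_mul h1 (mul_le_mul_of_nonneg_left h2 h3) (by positivity) (div_nonneg hc hlo.le)
        _ = c / lo * ((D - e) / D) * κ₀ := by ring
    · rw [hn₂s e he h2, zero_mul]
  rw [abs_mul, abs_of_pos (by positivity : (0 : ℝ) < 1 / D)]
  have htri := abs_add_le (∫ e in (0 : ℝ)..D, n₁ e * m e) (∫ e in (0 : ℝ)..D, n₂ e * ((D - e) / D * κ (e / D)))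
  calc 1 / D * |(∫ e in (0 : ℝ)..D, n₁ e * m e) + ∫ e in (0 : ℝ)..D, n₂ e * ((D - e) / D * κ (e / D))|
      ≤ 1 / D * (4 * c * κ₀ * lo / D + 4 * c * κ₀ * lo / D) :=
        mul_le_mul_of_nonneg_left (htri.trans (add_le_add hp1 hp2)) (by positivity)
    _ = 8 * c * κ₀ * lo / D ^ 2 := by field_simp; ring

/-! ## §4 Model B: `N(e,u) = ν(e)ν(u)`, `κ ≡ 1` -/

/-- **MODEL B (smooth steps) — the verification pattern.**  `ν ∈ C¹`, `ν(0) = 0`, `|ν| ≤ 1`, `|ν′| ≤ c/lo`, `ν′ = 0` on `[2lo, ∞)`; `0 < D`.  The `u`-derivative of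
`K(e,u) = ν(e)ν(u)/(e+u)` along the anti-diagonal is `ν(e)(ν′(D−e)/D − ν(D−e)/D²)`, and its line integral — the flatness number — satisfies
`|∫_0^D ν(e)(ν′(D−e)/D − ν(D−e)/D²) de| ≤ 8c·lo/D²`. -/
theorem abs_integral_antidiagonal_flatness_modelB_le {ν ν' : ℝ → ℝ} {D lo c : ℝ} (hD : 0 < D) (hlo : 0 < lo) (hc : 0 ≤ c)
    (hν : ∀ x, HasDerivAt ν (ν' x) x) (hν'c : Continuous ν') (hν0 : ν 0 = 0) (hνb : ∀ x, |ν x| ≤ 1)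
    (hν'b : ∀ x, |ν' x| ≤ c / lo) (hν's : ∀ x, 2 * lo ≤ x → ν' x = 0) :
    |∫ e in (0 : ℝ)..D, ν e * (ν' (D - e) / D - ν (D - e) / D ^ 2)| ≤ 8 * c * 1 * lo / D ^ 2 := by
  have hνc : Continuous ν := continuous_iff_continuousAt.2 fun x => (hν x).continuousAt
  -- the line quantities
  refine abs_integral_antidiagonal_flatness_le (n := fun e => ν e * ν (D - e)) (n₁ := fun e => ν' e * ν (D - e)) (n₂ := fun e => ν e * ν' (D - e))
    (κ := fun _ => (1 : ℝ)) (κ' := fun _ => (0 : ℝ)) hD hlo hc zero_le_one (fun e _ => ?_) (hν'c.mul (hνc.comp (continuous_const.sub continuous_id)))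
    (hνc.mul (hν'c.comp (continuous_const.sub continuous_id))) (fun t => by simpa using hasDerivAt_const t (1 : ℝ)) continuous_const
    (by simp [hν0]) (fun e _ => ?_) (fun e _ h2 => by simp [hν's e h2]) (fun e _ => ?_) (fun e _ h2 => by simp [hν's (D - e) (by linarith)])
    (fun t _ => by simp) (fun e _ => by simp; ring)
  · -- `d/de [ν(e)ν(D−e)] = ν′(e)ν(D−e) − ν(e)ν′(D−e)`
    have h1 : HasDerivAt (fun e : ℝ => ν (D - e)) (-ν' (D - e)) e := (hν (D - e)).comp_const_sub D e
    exact ((hν e).mul h1).congr_deriv (by ring)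
  · rw [abs_mul]
    calc |ν' e| * |ν (D - e)| ≤ c / lo * 1 := mul_le_mul (hν'b e) (hνb _) (abs_nonneg _) (div_nonneg hc hlo.le)
      _ = c / lo := mul_one _
  · rw [abs_mul]
    calc |ν e| * |ν' (D - e)| ≤ 1 * (c / lo) := mul_le_mul (hνb e) (hν'b _) (abs_nonneg _) zero_le_one
      _ = c / lo := one_mul _

/-- Model B: the formula IS the `u`-derivative of `K(e,u) = ν(e)ν(u)/(e+u)` at `u = D − e` (`0 < D`), by §1 with `κ ≡ 1`. -/
theorem hasDerivAt_modelB_u {ν : ℝ → ℝ} {ν'u e D : ℝ} (hD : e + (D - e) ≠ 0) (hν : HasDerivAt ν ν'u (D - e)) :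
    HasDerivAt (fun u : ℝ => ν e * ν u / (e + u)) (ν e * (ν'u / D - ν (D - e) / D ^ 2)) (D - e) := by
  have h := hasDerivAt_ratioKernel_u (Nu := fun u => ν e * ν u) (κ := fun _ => (1 : ℝ)) (κ' := 0) (e := e) (u := D - e) hD
    ((hν.const_mul (ν e))) (by simpa using hasDerivAt_const (e / (e + (D - e))) (1 : ℝ))
  simp only [mul_one, zero_mul, zero_add] at h
  have hs : e + (D - e) = D := by ring
  rw [hs] at h
  exact h.congr_deriv (by ring)

end Summit.HubbardSuperconductivity.HubbardSuperconductivity.Theorems.C4a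

end
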